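import Summits.Langlands.Langlands.Theorems.SoloInformedFontaineMazurGL1General
import Summits.Langlands.Langlands.Theorems.SoloInformedGLOneRationalField
import Summits.Langlands.Langlands.Theorems.SoloInformedGLOneRealPlace
import Literature.NumberTheory.GaloisRepresentations.DeRhamLAdicCharacterHeckeReduction
import HarnessLib

/-!
# SoloInformedGLOneGeneralField — rank-one Fontaine–Mazur and the repaired `GL₁` summit conjunct over
# EVERY number field with a real place, granting only the Lubin–Tate conjugate-admissibility fact (H)
# (solo-Langlands-informed s110, Stage D payoff)

Stage C (`SoloInformedGLOneRationalField`) decided the R3⁺-repaired `n = 1` conjunct over `ℚ` with no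
hypothesis, from Tate's theorem in degree one.  Stage D (`SoloInformedFontaineMazurGL1General`) proves
Tate's theorem "de Rham ⇒ locally algebraic" for rank-one characters of `Γ_F` for EVERY finite `F/ℚ_ℓ`,
granting the named Literature fact (H) `LubinTateCharacterConjugateAdmissible F ℓ hF hπ` (Serre 1968,
III.A.4–A.5: the non-identity conjugates of a Lubin–Tate character are `ℂ_F`-admissible near `1`).
Feeding it into the tree's global reduction
`FramedGaloisRep.exists_heckeCharacter_of_isDeRhamFramed_of_local` (Serre III §2.3 + CFT, proved in
tree) gives:

* ★★★ `existsHeckeCharacter_of_lubinTate` — **rank-one Fontaine–Mazur for every number field `K` and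
  every prime `ℓ`** (the tree's named fact `FramedGaloisRep.exists_heckeCharacter_of_isDeRhamFramed`),
  granting (H) at every `ℓ`-adic field;
* ★★★★ `globalLanglandsCorrespondenceGLnR3plus_one_of_isReal_of_lubinTate` /
  `…_of_odd_finrank_of_lubinTate` — **the R3⁺-repaired `GL₁` reciprocity conjunct
  `R3plus.GlobalLanglandsCorrespondenceGLnR3plus 1 K 𝓡 hcpt` for every number field `K` with a real
  place (in particular every `K` of odd degree), every reciprocity datum and every compactness
  witness**, granting (H) alone (Λ27 `globalLanglandsCorrespondenceGLnR3plus_one_of_fact_of_isReal`).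

Plain theorems; no definitions.

Citations: [SerreAbelianLadic1968] Ch. III §2.3 Thm. 2, App. A.4–A.7; [Tate1967] §3.3;
[FontaineMazurGeometric1995] Conj. 1; [Patrikis2019] Prop. 2.2.1; [BuzzardGeeLMS2014] Conj. 3.2.1–3.2.2.
-/

noncomputable section
open scoped MatrixGroups Matrix Classical NumberField
open NumberField IsDedekindDomain Field Filter ValuativeRel
open Literature.NumberTheory.Automorphic Literature.NumberTheory.GaloisRepresentations
open Literature.NumberTheory.PAdicHodge

namespace Summit.Langlands.Langlands.Theorems

namespace GLOneRigidity

/-- ★★★ **Rank-one Fontaine–Mazur for every number field, granting (H)**: the tree's named fact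
`FramedGaloisRep.exists_heckeCharacter_of_isDeRhamFramed` (a rank-one `ρ : Γ_K → GL₁(ℚ̄_ℓ)` de Rham
at every `v ∣ ℓ` comes from an algebraic Hecke character) follows from the Lubin–Tate
conjugate-admissibility fact (H) at every `ℓ`-adic field.
[cite: SerreAbelianLadic1968, Ch. III §2.3 Thm. 2 and App. A.5–A.7] [cite: Tate1967, §3.3]
[cite: Patrikis2019, Prop. 2.2.1] -/
theorem existsHeckeCharacter_of_lubinTate
    (hH : ∀ (F : Type) [Field F] [ValuativeRel F] [TopologicalSpace F] [IsNonarchimedeanLocalField F]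
      [CharZero F] (ℓ : ℕ) [Fact ℓ.Prime] (hF : valuation F ℓ < 1) (π : 𝒪[F])
      (hπ : (valuation F).IsUniformizer (π : F)), LubinTateCharacterConjugateAdmissible F ℓ hF hπ) :
    FramedGaloisRep.exists_heckeCharacter_of_isDeRhamFramed :=
  FramedGaloisRep.exists_heckeCharacter_of_isDeRhamFramed_of_local
    fun F _ _ _ _ _ ℓ _ hF ρ hρ => by
      obtain ⟨π, hπ⟩ := Valuation.exists_isUniformizer_of_isCyclic_of_nontrivial (valuation F)
      exact exists_isOpen_eq_prod_of_isDeRhamFramed_general hF hπ (hH F ℓ hF π hπ) ρ hρ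

section GeneralField

variable {K : Type} [Field K] [NumberField K] {hcpt : isCompact_glFiniteIntegralLevel 1 K}

/-- ★★★ **Rank-one Fontaine–Mazur over every number field `K` (pinned datum), granting (H)**: a
continuous `ρ : Γ_K → GL₁(ℚ̄_ℓ)` de Rham at every `v ∣ ℓ` is Weil's `r_{θ,ι}` for an algebraic Hecke
character `θ` of `K`. [cite: FontaineMazurGeometric1995, Conj. 1] [cite: Patrikis2019, Prop. 2.2.1]
[cite: SerreAbelianLadic1968, Ch. III §2.3 Thm. 2 and App. A] -/
theorem fontaineMazurOne_of_lubinTate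
    (hH : ∀ (F : Type) [Field F] [ValuativeRel F] [TopologicalSpace F] [IsNonarchimedeanLocalField F]
      [CharZero F] (ℓ : ℕ) [Fact ℓ.Prime] (hF : valuation F ℓ < 1) (π : 𝒪[F])
      (hπ : (valuation F).IsUniformizer (π : F)), LubinTateCharacterConjugateAdmissible F ℓ hF hπ)
    (𝓡 : ReciprocityData K) {ℓ : ℕ} [Fact ℓ.Prime]
    (ι : PadicAlgCl ℓ ≃+* ℂ) (ρ : FramedGaloisRep K (PadicAlgCl ℓ) 1)
    (hdR : ∀ (v : HeightOneSpectrum (𝓞 K)) (hv : ((ℓ : ℕ) : 𝓞 K) ∈ v.asIdeal),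
      (𝓡.pst ℓ v hv).IsDeRhamFramed (ρ.toLocal v)) :
    ∃ (θ : HeckeCharacter K) (p q : InfinitePlace K → ℤ) (hinf : θ.HasInfinityType p q)
      (T : Finset (HeightOneSpectrum (𝓞 K))) (e : HeightOneSpectrum (𝓞 K) → ℕ)
      (hmod : HeckeCharacter.IsModulus θ T e), ρ = hinf.weilRep hmod ι := by
  obtain ⟨χ, hχ, h⟩ := existsHeckeCharacter_of_lubinTate hH K ℓ ρ (fun v hv => hdR v hv) ι
  obtain ⟨p, q, hinf⟩ := χ.isAlgebraic_iff_exists_hasInfinityType.mp hχ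
  obtain ⟨T, e, hmod⟩ := χ.exists_isModulus
  exact ⟨χ, p, q, hinf, T, e, hmod,
    eq_weilRep_of_eventually_hasFrobCharpolyAt ι hinf hmod (h.mono fun v hv => hv.2.2)⟩

/-- ★★★★ **The R3⁺-repaired `GL₁` reciprocity conjunct holds over every number field with a real
place, granting (H) alone** — for every reciprocity datum and every compactness witness.
[cite: BuzzardGeeLMS2014, Conj. 3.2.1–3.2.2] [cite: FontaineMazurGeometric1995, Conj. 1]
[cite: SerreAbelianLadic1968, Ch. III §2.3 Thm. 2 and App. A.5–A.7] -/
theorem globalLanglandsCorrespondenceGLnR3plus_one_of_isReal_of_lubinTate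
    (hH : ∀ (F : Type) [Field F] [ValuativeRel F] [TopologicalSpace F] [IsNonarchimedeanLocalField F]
      [CharZero F] (ℓ : ℕ) [Fact ℓ.Prime] (hF : valuation F ℓ < 1) (π : 𝒪[F])
      (hπ : (valuation F).IsUniformizer (π : F)), LubinTateCharacterConjugateAdmissible F ℓ hF hπ)
    {w : InfinitePlace K} (hw : w.IsReal) (𝓡 : ReciprocityData K) :
    R3plus.GlobalLanglandsCorrespondenceGLnR3plus 1 K 𝓡 hcpt :=
  globalLanglandsCorrespondenceGLnR3plus_one_of_fact_of_isReal hw (existsHeckeCharacter_of_lubinTate hH) 𝓡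

/-- ★★★★ **The R3⁺-repaired `GL₁` reciprocity conjunct holds over every number field of odd degree,
granting (H) alone.** [cite: BuzzardGeeLMS2014, Conj. 3.2.1–3.2.2]
[cite: FontaineMazurGeometric1995, Conj. 1] [cite: SerreAbelianLadic1968, Ch. III App. A.5–A.7] -/
theorem globalLanglandsCorrespondenceGLnR3plus_one_of_odd_finrank_of_lubinTate
    (hH : ∀ (F : Type) [Field F] [ValuativeRel F] [TopologicalSpace F] [IsNonarchimedeanLocalField F]
      [CharZero F] (ℓ : ℕ) [Fact ℓ.Prime] (hF : valuation F ℓ < 1) (π : 𝒪[F])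
      (hπ : (valuation F).IsUniformizer (π : F)), LubinTateCharacterConjugateAdmissible F ℓ hF hπ)
    (hodd : Odd (Module.finrank ℚ K)) (𝓡 : ReciprocityData K) :
    R3plus.GlobalLanglandsCorrespondenceGLnR3plus 1 K 𝓡 hcpt :=
  globalLanglandsCorrespondenceGLnR3plus_one_of_fact_of_odd_finrank hodd
    (existsHeckeCharacter_of_lubinTate hH) 𝓡

end GeneralField

end GLOneRigidity

end Summit.Langlands.Langlands.Theorems

end
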